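import Mathlib
import HarnessLib
import Summits.HubbardSuperconductivity.HubbardSuperconductivity.Theorems.KLProgrammeKLRegimeVolumeLimitV12SrcTowerConsumersW
import Summits.HubbardSuperconductivity.HubbardSuperconductivity.Theorems.KLProgrammeKLRegimeTwoVolumeSrcTowerProducerFH
import Summits.HubbardSuperconductivity.HubbardSuperconductivity.Theorems.KLProgrammeKLRegimeVolumeLimitFlowFramesV17F3
import Summits.HubbardSuperconductivity.HubbardSuperconductivity.Theses.KLProgramme

/-!
# Route `KLProgramme` — crux K3, VL child `KLRegimeVolumeLimitV17F3` (stmt-HubbardSuperconductivity-23356), cure of LR13′/LR14, step C4: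
# THE CHILD BY NAME FROM THE THREE ATOMS OF THE v12W-7 SPEC OF RECORD (pen (R303)) — `HE1free`, the tower-bound (K5′) atom with an EXISTENTIAL
# constant `HOscT′`, the UV levels in the WINDOWED currency and HISTORY-BOUND `HUVWH` (p3 g21 «(VL)-HUV-FRAME») (seat hubbard-kl-k3c4-p1 g20;
# `--supports` 23356; Theses-importing closer module)

`…SrcTowerProducerFH.srcProfilesHF_of_atomsTH` (token #24-W at every level, history-bound) ∘ `…V12SrcTowerConsumersW` (both consumers re-keyed to the windowed
currency) ∘ `…FlowFramesV17F3.volumeLimitTextV17F3_of_framedNestedFlowText`.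

* **`KLRegimeVolumeLimitV17F3_of_atomsWH (HE1free) (HOscT′) (HUVWH)`** — `…Theses.KLProgramme.KLRegimeVolumeLimitV17F3` BY NAME.

Composition only; nothing asserts the atoms, K3 or superconductivity. [cite: BenfattoGiulianiMastropietro2006, §2.7–§2.9, §3]
-/

noncomputable section

open Finset Filter Topology Complex Literature.MathematicalPhysics.QuantumLattice Literature.Probability.LatticeModels GrassmannAlgebra
open Summit.HubbardSuperconductivity.HubbardSuperconductivity.Theorems.EngineV8
open Summit.HubbardSuperconductivity.HubbardSuperconductivity.Theorems.KLProgrammeLegKernels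
open Summit.HubbardSuperconductivity.HubbardSuperconductivity.Theorems.KLRegimeSplit
open Summit.HubbardSuperconductivity.HubbardSuperconductivity.Theorems.TwoPointAssembly
open Summit.HubbardSuperconductivity.HubbardSuperconductivity.Theorems.TwoVolumeDefect
open Summit.HubbardSuperconductivity.HubbardSuperconductivity.Theorems.TwoVolumeSource
open Summit.HubbardSuperconductivity.HubbardSuperconductivity.Theorems.TorusFourierL2

set_option linter.dupNamespace false -- summit = problem name (single-conjunct summit), D-0017

namespace Summit.HubbardSuperconductivity.HubbardSuperconductivity.Theorems.TwoVolumeSource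

/-- **THE CHILD `…Theses.KLProgramme.KLRegimeVolumeLimitV17F3` FROM THE THREE ATOMS OF v12W-7** — `stub_vl_HE1free`'s text, the tower-bound (K5′) export with
an existential constant `HOscT′` (= the conclusion of p2 g25's `…VolumeLimitHOscTOfChildren.hoscTAtom_of_children`), the UV levels in the WINDOWED currency, asked
under the top history, the (K5′) clauses and `Z ≠ 0` (`HUVWH`): producer `srcProfilesHF_of_atomsTH` at `F := srcWindowFamily`, data consumer `vl_towerDataW_WF2_of_HE1free_srcHW`, truncated closer `vl_nestedFramed_of_towerDataTSW_srcHW`,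
re-keyed text `volumeLimitTextV17F3_of_framedNestedFlowText`. [cite: BenfattoGiulianiMastropietro2006, §2.7-§2.9, §3] -/
theorem KLRegimeVolumeLimitV17F3_of_atomsWH
    (HE1free : (∀ (P : SplitConsts) (R : RenConsts), P.WF → R.WF2 →
      ∃ Q₁ : EngConsts, 0 ≤ Q₁.CE ∧ ∃ C₀ : ℝ, 0 ≤ C₀ ∧
        ∃ c₇ : ℝ, 0 < c₇ ∧ ∀ c : ℝ, 0 < c → c ≤ c₇ → ∃ U₇ : ℝ, 0 < U₇ ∧
          ∀ μ ∈ klWindowC, ∀ U : ℝ, 0 < U → U ≤ U₇ → ∀ β : ℝ, klBetaMin ≤ β → β ≤ Real.exp (c / U ^ 2) →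
            ∃ S₀ : ℕ → ℕ → ℝ, (∀ j m, 0 ≤ S₀ j m) ∧ (∀ j, j ≤ nScales β → ∀ m, 1 ≤ m → S₀ j (2 * m) ≤ C₀ * klWtBudget P Q₁ U (j + 1) (2 * m)) ∧
            ∃ L₂ : ℕ, ∃ M₂ : ℕ → ℕ, ∀ (L M : ℕ) [NeZero L] [NeZero M], L₂ ≤ L → M₂ L ≤ M →
              (∀ k, k ≤ nScales β → hubbardEffPartitionFnCT L M β U μ 0 (klFlowFrameU L M β U μ (nScales β + 1)) (klScale klE0 (k + 1)) ≠ 0) ∧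
              (∀ j, j ≤ nScales β → ∀ (m : ℕ) (q : Fin m) (w : SpaceTimeIdx L M × SectorLeg (sectorCount j)),
                klWtPinnedSumAt L M β μ (klFlowFrameU L M β U μ (nScales β + 1)) j j m (klEffectiveAction L M β U μ (klFlowFrameU L M β U μ (nScales β + 1)) klE0 (j + 1)) q w ≤ S₀ j m)))
    (HOscT' : (∀ (G : GeoConsts) (P : SplitConsts) (Q : EngConsts) (R : RenConsts), P.WF → R.WF2 →
      ∃ c'' : ℝ, 0 ≤ c'' ∧ ∃ c₇ : ℝ, 0 < c₇ ∧ ∀ c : ℝ, 0 < c → c ≤ c₇ → ∃ U₇ : ℝ, 0 < U₇ ∧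
        ∀ μ ∈ klWindowC, ∀ U : ℝ, 0 < U → U ≤ U₇ → ∀ β : ℝ, klBetaMin ≤ β → β ≤ Real.exp (c / U ^ 2) →
          ∀ (K : TrigPolyC4v) (Lstar : ℕ) (Mstar : ℕ → ℕ), TowerP klPredsV17F2 G P Q R β U μ K Lstar Mstar →
          ∃ L₂ : ℕ, ∃ M₂ : ℕ → ℕ, ∀ (L M : ℕ) [NeZero L] [NeZero M], L₂ ≤ L → M₂ L ≤ M →
            ∀ m : ℕ, 1 ≤ m → m < nScales β + 1 → FlowPieceOscAt L M c'' β U μ m))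
    (HUVWH : (∀ (G : GeoConsts) (P : SplitConsts) (Q : EngConsts) (R : RenConsts), P.WF → R.WF2 → ∀ c'' : ℝ, 0 < c'' →
      ∃ Q₀ : EngConsts, 0 ≤ Q₀.CE ∧ ∃ c₀ : ℝ, 0 < c₀ ∧ ∀ c : ℝ, 0 < c → c ≤ c₀ → ∃ U₀ : ℝ, 0 < U₀ ∧
        ∀ μ ∈ klWindowC, ∀ U : ℝ, 0 < U → U ≤ U₀ → ∀ β : ℝ, klBetaMin ≤ β → β ≤ Real.exp (c / U ^ 2) →
          ∃ A₀ : ℝ, 0 ≤ A₀ ∧ ∃ L₁ : ℕ, ∃ M₁ : ℕ → ℕ, ∀ (L M : ℕ) [NeZero L] [NeZero M], L₁ ≤ L → M₁ L ≤ M →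
            HistP klPredsV17F2 L M G P Q R β U μ 0 (nScales β + 1) →
            (∀ m : ℕ, 1 ≤ m → m < nScales β + 1 → FlowPieceOscAt L M c'' β U μ m) →
            (∀ k, k ≤ nScales β → hubbardEffPartitionFnCT L M β U μ 0 (klFlowFrameU L M β U μ (nScales β + 1)) (klScale klE0 (k + 1)) ≠ 0) →
            ∀ j : ℕ, j ≤ 1 → j + 1 ≤ nScales β + 1 →
              SourceProfilesAtLevF L M (klSrcBudget P Q₀ U (fun _ _ => A₀) (j + 1)) β U μ (klFlowFrameU L M β U μ (nScales β + 1)) (srcWindowFamily L M) j j (j + 1))) :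
    Summit.HubbardSuperconductivity.HubbardSuperconductivity.Theses.KLProgramme.KLRegimeVolumeLimitV17F3 :=
  volumeLimitTextV17F3_of_framedNestedFlowText
    (vl_nestedFramed_of_towerDataTSW_srcHW (srcProfilesHF_of_atomsTH HE1free HOscT' srcWindowFamily HUVWH)
      (vl_towerDataW_WF2_of_HE1free_srcHW HE1free (srcProfilesHF_of_atomsTH HE1free HOscT' srcWindowFamily HUVWH)))

end Summit.HubbardSuperconductivity.HubbardSuperconductivity.Theorems.TwoVolumeSource

end
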